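import Summits.ResolutionOfSingularities.KangarooAtlas.MizutaniExtremalIff
import HarnessLib

/-!
# Mizutani's Thm. 2.8 (second part) as an ORBIT statement: the extremal points are the projective transforms of the model points

Cell `pub-rosobs`, Mizutani enclosure (seat mizutani-encloser-2, gen 8). AI-written; AI review is weaker than expert review;
NOT a resolution-of-singularities theorem (summit relevance C).

Mizutani (Nagoya Math. J. 52 (1973) p. 87) defines the TYPE of a pair `(V, W)` up to a field automorphism of `k` and a `k^q`-semilinear
automorphism `ψ` of `W`; Thm. 2.8 (second part): an extremal `H` «is of the same type as Example 2.1».  With the `GL_{n+1}(k)`-equivariance of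
the dictionary (`MizutaniCoordChange.lean`: a `k^p`-linear automorphism of `W = ⊕ k^p X_i` with matrix `N` is the projective coordinate change
`σ_M`, `M = N^{[1/p]}`) and the explicit MODEL POINTS `GenAtt.attP k p 1 u = [(u_0^ε u_1^j)^{1/p}]` (`u` a `p`-independent pair) of the tree,
the theorem and its converse (`MizutaniExtremalIff.lean`) become an orbit statement:

* `GenAtt.linearIndependent_attC` — the model coordinates `u_0^ε u_1^j` are `k^{p^e}`-independent;
* `exists_coordChange_attP_of_span_eq` — a `k^p`-basis `c` of `k^p(y₀) ⊕ k^p(y₀)·y₁` is `M^{[p]} *ᵥ attC(y₁, y₀)` with `M` invertible, i.e.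
  `[c^{1/p}] = σ_M^{-1}(attP(y₁, y₀))`;
* **`extremal_iff_exists_coordChange_attP`** — a homogeneous ideal `𝔭 ⊂ k[X_0, …, X_{2p−1}]` is an extremal point (a point, no linear form,
  `(L_B)_1 ≠ 0`, `dim B + 1 = 2p` at level one) **iff** `𝔭 = σ_M^{-1}(attP(u))` for some `M ∈ GL_{2p}(k)` and some `p`-independent pair `u`.

## References

* H. Mizutani, *Hironaka's additive group schemes*, Nagoya Math. J. 52 (1973) 85–95, Example 2.1, p. 87 (type), Thm. 2.8.
  [Mizutani1973HironakaGroupSchemes]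
-/

noncomputable section

open MvPolynomial Literature.AlgebraicGeometry.Resolution Literature.AlgebraicGeometry.Resolution.HironakaScheme
open Literature.RingTheory.MvPolynomial

namespace Summit.ResolutionOfSingularities.KangarooAtlas.Mizutani

universe u

section Orbit

variable (k : Type u) [Field k] (p : ℕ) [hp : Fact p.Prime] [CharP k p]

/-- The coordinates `u_0^{ε_i} u_1^{j_i}` of the attained point are `k^{p^e}`-linearly independent for a `p`-independent pair (`e ≥ 1`): they are
distinct box monomials. [cite: Mizutani1973HironakaGroupSchemes, Remark 2.10 (the schemes H_e)] -/
theorem GenAtt.linearIndependent_attC {e : ℕ} {u : Fin 2 → k} (hu : PIndep p e u) (he : 1 ≤ e) :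
    LinearIndependent (frobPow k p e) (GenAtt.attC k p e u) := by
  have h2 : 2 ≤ p ^ e := le_trans hp.out.two_le (by
    calc p = p ^ 1 := (pow_one p).symm
      _ ≤ p ^ e := Nat.pow_le_pow_right hp.out.pos he)
  set ι : Fin (attN p e + 1) → (Fin 2 → Fin (p ^ e)) := fun i => ![Fin.castLE h2 (attIdx p e i).1, (attIdx p e i).2] with hι
  have hιinj : Function.Injective ι := by
    intro i j hij
    have h0 := congr_fun hij 0
    have h1 := congr_fun hij 1
    simp only [hι, Matrix.cons_val_zero, Matrix.cons_val_one] at h0 h1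
    exact (attIdx p e).injective (Prod.ext (Fin.castLE_injective h2 h0) h1)
  have heq : GenAtt.attC k p e u = (fun W : Fin 2 → Fin (p ^ e) => fmon u W) ∘ ι := by
    funext i
    unfold GenAtt.attC fmon
    rw [Function.comp_apply, Fin.prod_univ_two, Fin.prod_univ_two, attW_zero, attW_one]
    simp only [hι, Matrix.cons_val_zero, Matrix.cons_val_one, Fin.val_castLE]
  rw [heq]
  exact hu.comp ι hιinj

/-- **A `k^p`-basis of `k^p(y₀) ⊕ k^p(y₀)·y₁` is a twisted projective transform of the model coordinates**: if `c` is `k^p`-independent with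
`span_{k^p}{c_i} = span_{k^p}{y₀^m y₁^j}` then `[c^{1/p}] = σ_M^{-1}(attP(y₁, y₀))` for an invertible `M` (the `p`-th root of the base change).
[cite: Mizutani1973HironakaGroupSchemes, p. 87 (type: a k^q-semilinear automorphism ψ of W)] -/
theorem exists_coordChange_attP_of_span_eq {y : Fin 2 → k} {c : Fin (attN p 1 + 1) → k}
    (hc : LinearIndependent (frobPow k p 1) c)
    (hspan : Submodule.span (frobPow k p 1) (Set.range c) =
      Submodule.span (frobPow k p 1) (Set.range fun mj : Fin p × Fin 2 => y 0 ^ (mj.1 : ℕ) * y 1 ^ (mj.2 : ℕ))) :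
    ∃ M : Matrix (Fin (attN p 1 + 1)) (Fin (attN p 1 + 1)) k, IsUnit M.det ∧
      ratPoint k p 1 c = (GenAtt.attP k p 1 ![y 1, y 0]).comap (aeval fun j => linForm (M j)) := by
  classical
  set u : Fin 2 → k := ![y 1, y 0] with hu_def
  set v := GenAtt.attC k p 1 u with hv
  have hspan' : Submodule.span (frobPow k p 1) (Set.range c) = Submodule.span (frobPow k p 1) (Set.range v) := by
    rw [hspan, hv, hu_def, range_attC_swap]
  have hmem : ∀ j, c j ∈ Submodule.span (frobPow k p 1) (Set.range v) := fun j =>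
    hspan' ▸ Submodule.subset_span ⟨j, rfl⟩
  choose N hN using fun j => (Submodule.mem_span_range_iff_exists_fun (frobPow k p 1)).mp (hmem j)
  have hroot : ∀ j i, ∃ m : k, m ^ p ^ 1 = (N j i : k) := fun j i => mem_frobPow_iff.mp (N j i).2
  choose m hm using hroot
  set M : Matrix (Fin (attN p 1 + 1)) (Fin (attN p 1 + 1)) k := Matrix.of m with hM
  have hMmap : (M.map fun x => x ^ p ^ 1) = (frobPow k p 1).subtype.mapMatrix (Matrix.of N) := by
    ext j i
    rw [Matrix.map_apply, hM, Matrix.of_apply, hm, RingHom.mapMatrix_apply, Matrix.map_apply, Matrix.of_apply,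
      Subfield.coe_subtype]
  have hc_eq : (M.map fun x => x ^ p ^ 1).mulVec v = c := by
    funext j
    rw [Matrix.mulVec, dotProduct, ← hN j]
    refine Finset.sum_congr rfl fun i _ => ?_
    rw [Matrix.map_apply, hM, Matrix.of_apply, hm, Subfield.smul_def, smul_eq_mul]
  have hdetN : (Matrix.of N).det ≠ 0 := by
    intro h0
    obtain ⟨w, hw0, hw⟩ := Matrix.exists_vecMul_eq_zero_iff.mpr h0
    apply hw0
    have hsum : ∑ j, w j • c j = 0 := by
      calc ∑ j, w j • c j = ∑ j, w j • ∑ i, N j i • v i := by simp_rw [hN]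
        _ = ∑ i, (Matrix.vecMul w (Matrix.of N)) i • v i := by
            simp_rw [Finset.smul_sum, smul_smul]
            rw [Finset.sum_comm]
            refine Finset.sum_congr rfl fun i _ => ?_
            rw [Matrix.vecMul, dotProduct, Finset.sum_smul]
            rfl
        _ = 0 := by rw [hw]; simp
    exact funext fun j => Fintype.linearIndependent_iff.mp hc w hsum j
  have hdet : IsUnit M.det := by
    rw [isUnit_iff_ne_zero]
    intro h0
    apply hdetN
    have h2 : (M.map fun x => x ^ p ^ 1) = (iterateFrobenius k p 1).mapMatrix M := by
      ext j i; rw [RingHom.mapMatrix_apply, Matrix.map_apply, Matrix.map_apply, iterateFrobenius_def]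
    have h1 : (M.map fun x => x ^ p ^ 1).det = 0 := by
      rw [h2, ← RingHom.map_det, h0, map_zero]
    rw [hMmap, ← RingHom.map_det] at h1
    exact (map_eq_zero_iff _ (frobPow k p 1).subtype_injective).mp h1
  refine ⟨M, hdet, ?_⟩
  rw [GenAtt.attP_eq_ratPoint, comap_aeval_linForm_ratPoint, ← hv, hc_eq]

/-- **THM. 2.8 (SECOND PART) WITH EXAMPLE 2.1, AS AN ORBIT STATEMENT**: a homogeneous ideal `𝔭 ⊂ k[X_0, …, X_{2p−1}]` is an extremal point
(a point, no linear form through it, `(L_B)_1 ≠ 0`, `dim B + 1 = 2p` at level one) **iff** `𝔭 = σ_M^{-1}(attP(u))` is a projective transform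
(`M ∈ GL_{2p}(k)`) of one of the model points `GenAtt.attP k p 1 u = [(u_0^ε u_1^j)^{1/p}]`, `u` a `p`-independent pair of `k` — Mizutani's
«of the same type as Example 2.1» with the type realised by the explicit points of the tree and the `k^p`-semilinear automorphisms of `W`
realised as projective coordinate changes (`MizutaniCoordChange`). [cite: Mizutani1973HironakaGroupSchemes, Example 2.1, p. 87 (type), Thm. 2.8 (second part)] -/
theorem extremal_iff_exists_coordChange_attP (𝔭 : Ideal (MvPolynomial (Fin (attN p 1 + 1)) k)) :
    (IsPoint k 𝔭 ∧ invForms k p 𝔭 0 = ⊥ ∧ invForms k p 𝔭 1 ≠ ⊥ ∧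
      attN p 1 + 2 = 2 * p + Module.finrank k (invForms k p 𝔭 1)) ↔
    ∃ (M : Matrix (Fin (attN p 1 + 1)) (Fin (attN p 1 + 1)) k) (u : Fin 2 → k), IsUnit M.det ∧ PIndep p 1 u ∧
      𝔭 = (GenAtt.attP k p 1 u).comap (aeval fun j => linForm (M j)) := by
  classical
  have hN : attN p 1 + 1 = 2 * p := by have := attN_succ p 1; rwa [pow_one] at this
  constructor
  · rintro ⟨hP, h0, hV, hdim⟩
    obtain ⟨-, c, y, -, hcind, heq, hy, hspan⟩ := exists_pIndep_span_eq_of_extremal k p 𝔭 hP h0 hV hdim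
    obtain ⟨M, hM, hc⟩ := exists_coordChange_attP_of_span_eq k p hcind hspan
    exact ⟨M, ![y 1, y 0], hM, pIndep_swap hy, heq.trans hc⟩
  · rintro ⟨M, u, hM, hu, rfl⟩
    have hv := GenAtt.linearIndependent_attC k p hu le_rfl
    have hv0 : GenAtt.attC k p 1 u ≠ 0 := fun h => hv.ne_zero 0 (congr_fun h 0)
    have hU : IsUnit (M.map fun x => x ^ p ^ 1) := (Matrix.isUnit_iff_isUnit_det _).mpr (isUnit_det_map_pow k p hM 1)
    -- the transform is the rational point of `M^{[p]} c`
    have heq : (GenAtt.attP k p 1 u).comap (aeval fun j => linForm (M j)) =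
        ratPoint k p 1 ((M.map fun x => x ^ p ^ 1).mulVec (GenAtt.attC k p 1 u)) := by
      rw [GenAtt.attP_eq_ratPoint, comap_aeval_linForm_ratPoint]
    have hw0 : (M.map fun x => x ^ p ^ 1).mulVec (GenAtt.attC k p 1 u) ≠ 0 := by
      intro h
      apply hv0
      exact Matrix.mulVec_injective_iff_isUnit.mpr hU (by rw [h, Matrix.mulVec_zero])
    refine ⟨by rw [heq]; exact isPoint_ratPoint hw0, ?_, ?_, ?_⟩
    · rw [invForms_comap_eq, GenAtt.attP_eq_ratPoint, invForms_ratPoint_zero_eq_bot hv, Submodule.comap_bot,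
        LinearMap.ker_eq_bot]
      exact (bijective_vecMulLinear_map_pow k p hM 0).1
    · intro h
      have h1 := finrank_invForms_comap k p hM (GenAtt.attP k p 1 u) 1
      rw [h, finrank_bot, GenAtt.finrank_invForms_attP hu le_rfl] at h1
      exact zero_ne_one h1
    · rw [finrank_invForms_comap k p hM, GenAtt.finrank_invForms_attP hu le_rfl]
      omega

end Orbit

end Summit.ResolutionOfSingularities.KangarooAtlas.Mizutani

end
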